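/-
Copyright: the b2b-balaban T⁴-continuum CRUX team, row NE7b OWNER lineage `t4-ne7b-p1` (gen 129). Project licence.
-/
import Summits.QuantumFields.BalabanUV.T4Continuum.Spine.NE7b.SupSmallFieldGasReal

/-!
# THE ALL-FIELD ASSEMBLY OF ONE FLUCTUATION STEP: for the road's integrand `e^{−Σ_{p∈C}Σ_{x∈cell p}w_x(ω_x+ψ_x)}` over a finite-range
# Gaussian scale and ANY external field `ψ`, split the cells `C = S ⊔ L` with `ψ` SMALL on the cells of `S` (`Σ_{cell p}ψ² ≤ Ψ²`) and
# ARBITRARY on `L`; then `log Z_ψ(S ⊔ L)` obeys ONE extensive two-sided bound — `O(ε)` per small-field cell (the small-field region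
# theorem (296) at couplings `1` and `2`, made REAL by (306)) plus, per large-field site, a constant and a QUADRATIC polynomial in `ψ` (the
# a-priori bounds (297) at couplings `±2`) — glued by (305)'s Hölder sandwich, with NO polymer touching a hole and NO locality input between
# the two regions (row NE7b, node U5c; (305) + (306) + (297) BY NAME; [folklore])

Cell `pub-balaban`, sub-cell `t4`, spine estimate NE7b (`T4WeightBudget.RelWeightBound`; the cell's OWN estimate — NOT PRINTED in
[Bałaban 1983–89], NOT PROVED).  Crux-route work under `Spine/NE7b/` by the row OWNER (`t4-ne7b-p1` gen 129, file (307)) under FREEZE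
(0)'s crux-prover clause, on § [NE7bP1-G128-HANDOFF] NEXT (3)(a) («THE ASSEMBLY at one scale for ALL external fields»); NOTHING of
Bałaban's is named as a Lean object, valued or asserted; no `T4Continuum/Support` leaf typed; no `def`, no notation; zero `sorry`.  Imports
(BY NAME): the OWNER's (306) `…SupSmallFieldGasReal` (`abs_log_integral_smallField_le`, `log_integral_largeField_le`, `two_mul_log_sub_le`,
`cellSum_eq_sum_biUnion`, `measurable_cellSum`) and through it (305) (`log_integral_exp_neg_add_le`, `integrable_exp_neg_add`) and (297)
(`integrable_exp_neg`, `le_integral_exp_neg`); Mathlib's `Real.HolderConjugate.two_two`.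

WHY (located; DECISION SCOPING-d3 of this generation, see (305)'s header).  No `ψ`-uniform EXPANSION exists near a hole at fixed `ψ`;
what the next scale consumes is the extensive BOUND `|log Z_ψ(C)| ≤ c·ε·#S + Σ_{x ∈ sites of L}(c' + c″ψ_x²)` (the large-field part is then
paid by the Peierls weights (294)∕(304) where `ψ` is large).  Hölder with exponents `2, 2` above and the reversed split with `θ = ½`
below reduce `log Z_ψ(S ⊔ L)` to FOUR PURE quantities: the small-field gas on `S` at couplings `1` and `2` (remainders `w`, `2w` — again
stable and cubically small, so (306) applies), and the hole integrals on `L` at couplings `2` (stability `w ≥ −κ₀t²`) and `−2` (the upper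
quadratic bound `w ≤ κ₁t²`, which the road's class `−λ ≤ u″ ≤ Λ` supplies with `κ₀ = κ₁ = ½(λ+Λ)`), both (297).

WHAT IS PROVED ([folklore]; `μ = N(0,Γ)` on `ι → ℝ`, cells pairwise disjoint of `≤ v` sites, `Y_L = ⋃_{p∈L}cell p`, `c(k) = (2k(1+τ)γ∕(2θ))·(−log(1−θ))`,
`ε_t = max(e^{tc₃vh³}−1, 2e^{−(κ∕2−tκ₀)h²})·e^{½κ(1+τ⁻¹)Ψ²}`, `A_τ = (1−θ)^{−κ(1+τ)γ∕(2θ)}`):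
* **`log_integral_allField_le`** (UPPER): `Γ ⪰ 0` of range `ρ`, `Γ ⪯ γ_op·1`, diagonal `≤ γ`; `R` symmetric covering `ρ`-closeness with
  `≤ Δ` neighbours; stable (`κ₀`), cubically small (`c₃` on `|t| ≤ h`) measurable remainders; `4κ₀ ≤ κ`, `κ(1+τ)γ_op ≤ θ < 1`; `S, L` disjoint;
  `ψ` small on the cells of `S` ONLY; `e·ε₂A_τ^v(Δ+1)² ≤ 1∕2` ⟹
  `log Z_ψ(S ⊔ L) ≤ ½·#S(Δ+1)2e·ε₂A_τ^v + ½·(#Y_L·c(2κ₀) + 2κ₀(1+τ⁻¹)Σ_{x∈Y_L}ψ_x²)`;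
* **`le_log_integral_allField`** (LOWER, Hölder): additionally `w ≤ κ₁t²` (`κ₁ ≥ 0`, `4κ₁(1+τ)γ_op ≤ θ`) and `e·ε₁A_τ^v(Δ+1)² ≤ 1∕2` ⟹
  `log Z_ψ(S ⊔ L) ≥ −2·#S(Δ+1)2e·ε₁A_τ^v − ½·#S(Δ+1)2e·ε₂A_τ^v − ½·(#Y_L·c(2κ₁) + 2κ₁(1+τ⁻¹)Σ_{x∈Y_L}ψ_x²)`;
* `le_log_integral_allField_jensen` (LOWER, Jensen) for globally cubic remainders: (297) verbatim on all the sites of `S ∪ L`; §2 toy.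

HONEST (what this is NOT).  A two-sided BOUND at every `ψ`, not an expansion near the holes; the small-field part IS the convergent
expansion of (296) (local, `O(ε)`), the large-field part is crude (constant + quadratic per site) and is to be paid by (294)∕(304) at the
next Gaussian step — that pairing, and the choice `S = S(ψ)`, `L = L(ψ)` by a threshold, are the successor's bookkeeping; scalar skeleton
((A3), NC-NE7b-α UNRULED); nothing of Bałaban's asserted.  BY-NAME EFFECT ON THE WALL: NONE.  NE7b NOT PRINTED ∕ NOT PROVED; spine PROVED
0∕9; rung (B)+1 — the programme's measures remain FINITE-torus statements; NOT the mass gap, NOT Clay.  HONEST DEPENDENCY: continuum YM on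
T⁴ ⇐ BetaPertH ∧ nine spine estimates (0∕9 proved); BetaPertH ⇐ (D1) ∧ (D4) ∧ CAP+tail; G-an2-4 gates asym, D1 and NE2∕3∕4.
-/

set_option autoImplicit false

noncomputable section

namespace Summit.QuantumFields.BalabanUV.T4Continuum.NE7b.SupAllFieldAssembly

open MeasureTheory ProbabilityTheory Finset Real
open scoped BigOperators
open Literature.Analysis.Matrix (HasFiniteRange)
open SupMixedRegionHoelder (log_integral_exp_neg_add_le integrable_exp_neg_add)
open SupFluctuationAPriori (integrable_exp_neg le_integral_exp_neg)
open SupSmallFieldGasReal (abs_log_integral_smallField_le log_integral_largeField_le two_mul_log_sub_le cellSum_eq_sum_biUnion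
  measurable_cellSum)

variable {ι : Type} [Fintype ι] [DecidableEq ι] {V : Type*} [DecidableEq V]

/-! ## §1. THE END: the all-field assembly -/

section Assembly

variable {Γ : Matrix ι ι ℝ} {γop γ : ℝ} {dι : ι → ι → ℕ} {ρ : ℕ} {cell : V → Finset ι} {v : ℕ} {R : V → V → Prop}
  [DecidableRel R] [Std.Symm R] {nbr : V → Finset V} {Δ : ℕ} {w : ι → ℝ → ℝ} {κ₀ κ₁ c₃ h κ τ θ Ψ : ℝ}

/-- **THE END, UPPER — `log Z_ψ(S ⊔ L) ≤ ½·[small-field gas at coupling 2] + ½·[hole integral at coupling 2]`.**  `Γ ⪰ 0` of range `ρ`,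
`Γ ⪯ γ_op·1`, diagonal `≤ γ` (`γ ≥ 0`); disjoint cells of `≤ v` sites; `R` symmetric covering `ρ`-closeness with `≤ Δ` neighbours; measurable
remainders, stable (`κ₀ ≥ 0`) and cubically small on `|t| ≤ h` (`c₃, h ≥ 0`); `4κ₀ ≤ κ`, `0 < τ`, `0 < θ < 1`, `κ(1+τ)γ_op ≤ θ`; `S, L`
disjoint; `Σ_{x∈cell p}ψ_x² ≤ Ψ²` for `p ∈ S` ONLY; `e·ε₂A_τ^v(Δ+1)² ≤ 1∕2` with `ε₂ = max(e^{2c₃vh³}−1, 2e^{−(κ∕2−2κ₀)h²})e^{½κ(1+τ⁻¹)Ψ²}` ⟹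
`log ∫e^{−Σ_{p∈S∪L}Σ_{x∈cell p}w_x(ω_x+ψ_x)}dN(0,Γ) ≤ ½·#S(Δ+1)2e·ε₂A_τ^v + ½·(#Y_L·(4κ₀(1+τ)γ∕(2θ))(−log(1−θ)) + 2κ₀(1+τ⁻¹)Σ_{x∈Y_L}ψ_x²)`,
`Y_L = ⋃_{p∈L}cell p`. [folklore] -/
theorem log_integral_allField_le (hΓ : Γ.PosSemidef) (hΓop : (γop • (1 : Matrix ι ι ℝ) - Γ).PosSemidef) (hdiag : ∀ i, Γ i i ≤ γ)
    (hγ : 0 ≤ γ) (hfr : HasFiniteRange dι ρ Γ) (hdisj : ∀ p q, p ≠ q → Disjoint (cell p) (cell q)) (hv : ∀ p, (cell p).card ≤ v)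
    (hR : ∀ (p p' : V) (x y : ι), x ∈ cell p → y ∈ cell p' → dι x y ≤ ρ → p = p' ∨ R p p')
    (hΔ : ∀ x, (nbr x).card ≤ Δ) (hnbr : ∀ x y, R x y → y ∈ nbr x) (hw : ∀ x, Measurable (w x)) (hκ₀ : 0 ≤ κ₀) (hc₃ : 0 ≤ c₃)
    (hh : 0 ≤ h) (hstab : ∀ x, ∀ t : ℝ, -(κ₀ * t ^ 2) ≤ w x t) (hcub : ∀ x, ∀ t : ℝ, |t| ≤ h → |w x t| ≤ c₃ * |t| ^ 3)
    (hκ : 4 * κ₀ ≤ κ) (hτ : 0 < τ) (hθ0 : 0 < θ) (hθ1 : θ < 1) (hκθ : κ * (1 + τ) * γop ≤ θ) (S L : Finset V)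
    (hSL : Disjoint S L) (ψ : EuclideanSpace ℝ ι) (hψ : ∀ p ∈ S, ∑ x ∈ cell p, ψ x ^ 2 ≤ Ψ ^ 2)
    (hsmall₂ : Real.exp 1 * (((max (exp (2 * c₃ * v * h ^ 3) - 1) (2 * exp (-((κ / 2 - 2 * κ₀) * h ^ 2)))) *
      exp (κ * (1 + τ⁻¹) * Ψ ^ 2 / 2)) * ((1 - θ) ^ (-(κ * (1 + τ) * γ / (2 * θ)))) ^ v) * ((Δ : ℝ) + 1) ^ 2 ≤ 1 / 2) :
    log (∫ ω : EuclideanSpace ℝ ι, exp (-(∑ p ∈ S ∪ L, ∑ x ∈ cell p, w x (ω x + ψ x))) ∂(multivariateGaussian 0 Γ)) ≤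
      (1 / 2) * (S.card * ((Δ : ℝ) + 1) * (2 * (Real.exp 1 * (((max (exp (2 * c₃ * v * h ^ 3) - 1)
        (2 * exp (-((κ / 2 - 2 * κ₀) * h ^ 2)))) * exp (κ * (1 + τ⁻¹) * Ψ ^ 2 / 2)) *
        ((1 - θ) ^ (-(κ * (1 + τ) * γ / (2 * θ)))) ^ v)))) +
      (1 / 2) * ((L.biUnion cell).card * (2 * (2 * κ₀) * (1 + τ) * γ / (2 * θ)) * (-log (1 - θ)) +
        2 * κ₀ * (1 + τ⁻¹) * ∑ x ∈ L.biUnion cell, ψ x ^ 2) := by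
  set μ := multivariateGaussian 0 Γ with hμ
  -- the two potentials
  set A : EuclideanSpace ℝ ι → ℝ := fun ω => ∑ p ∈ S, ∑ x ∈ cell p, w x (ω x + ψ x) with hA
  set B : EuclideanSpace ℝ ι → ℝ := fun ω => ∑ p ∈ L, ∑ x ∈ cell p, w x (ω x + ψ x) with hB
  have hAm : Measurable A := measurable_cellSum cell w hw S (fun x => ψ x)
  have hBm : Measurable B := measurable_cellSum cell w hw L (fun x => ψ x)
  have hsplit : ∀ ω : EuclideanSpace ℝ ι, ∑ p ∈ S ∪ L, ∑ x ∈ cell p, w x (ω x + ψ x) = A ω + B ω := fun ω => sum_union hSL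
  simp_rw [hsplit]
  -- the doubled remainder `2w` is stable with `2κ₀` and cubically small with `2c₃`
  have hstab2 : ∀ x, ∀ t : ℝ, -(2 * κ₀ * t ^ 2) ≤ (fun x t => 2 * w x t) x t := fun x t => by
    have := hstab x t; simp only; linarith
  have hcub2 : ∀ x, ∀ t : ℝ, |t| ≤ h → |(fun x t => 2 * w x t) x t| ≤ 2 * c₃ * |t| ^ 3 := fun x t ht => by
    simp only [abs_mul, abs_two]; nlinarith [hcub x t ht]
  have hw2 : ∀ x, Measurable ((fun x t => 2 * w x t) x) := fun x => (hw x).const_mul 2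
  have hκ2 : 2 * (2 * κ₀) ≤ κ := by linarith
  have h2κ₀ : 0 ≤ 2 * κ₀ := by linarith
  have hκθ' : 2 * (2 * κ₀) * (1 + τ) * γop ≤ θ := by
    have hγop : 0 ≤ (1 + τ) * γop ∨ (1 + τ) * γop < 0 := le_or_gt 0 _
    rcases hγop with hpos | hneg
    · calc 2 * (2 * κ₀) * (1 + τ) * γop = (2 * (2 * κ₀)) * ((1 + τ) * γop) := by ring
        _ ≤ κ * ((1 + τ) * γop) := mul_le_mul_of_nonneg_right hκ2 hpos
        _ = κ * (1 + τ) * γop := by ring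
        _ ≤ θ := hκθ
    · have : 2 * (2 * κ₀) * (1 + τ) * γop ≤ 0 := by
        have : 2 * (2 * κ₀) * (1 + τ) * γop = (2 * (2 * κ₀)) * ((1 + τ) * γop) := by ring
        rw [this]; exact mul_nonpos_of_nonneg_of_nonpos (by linarith) hneg.le
      linarith
  -- integrability of `e^{−2A}` and `e^{−2B}` ((297) for the remainder `2w` on the sites of `S`, `L`)
  have hIA : Integrable (fun ω => exp (-(2 * A ω))) μ := by
    have h := integrable_exp_neg hΓ hΓop (S.biUnion cell) (fun x t => 2 * w x t) hw2 h2κ₀ hτ hθ1 hκθ' hstab2 (fun x => ψ x)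
    refine h.congr (ae_of_all _ fun ω => ?_)
    simp only [hA]
    rw [← cellSum_eq_sum_biUnion cell hdisj S, mul_sum]
    simp_rw [mul_sum]
  have hIB : Integrable (fun ω => exp (-(2 * B ω))) μ := by
    have h := integrable_exp_neg hΓ hΓop (L.biUnion cell) (fun x t => 2 * w x t) hw2 h2κ₀ hτ hθ1 hκθ' hstab2 (fun x => ψ x)
    refine h.congr (ae_of_all _ fun ω => ?_)
    simp only [hB]
    rw [← cellSum_eq_sum_biUnion cell hdisj L, mul_sum]
    simp_rw [mul_sum]
  -- Hölder above with exponents `2, 2`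
  have hH := log_integral_exp_neg_add_le (μ := μ) hAm hBm Real.HolderConjugate.two_two hIA hIB
  -- the pure small-field quantity at coupling `2`
  have hPa : log (∫ ω, exp (-(2 * A ω)) ∂μ) ≤ S.card * ((Δ : ℝ) + 1) * (2 * (Real.exp 1 *
      (((max (exp (2 * c₃ * v * h ^ 3) - 1) (2 * exp (-((κ / 2 - 2 * κ₀) * h ^ 2)))) * exp (κ * (1 + τ⁻¹) * Ψ ^ 2 / 2)) *
        ((1 - θ) ^ (-(κ * (1 + τ) * γ / (2 * θ)))) ^ v))) := by
    have h := abs_log_integral_smallField_le hΓ hΓop hdiag hγ hfr cell hdisj hv hR hΔ hnbr (fun x t => 2 * w x t) hw2 h2κ₀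
      (by positivity) hh hstab2 hcub2 hκ2 hτ hθ0 hθ1 hκθ S ψ hψ hsmall₂
    have hint : ∫ ω : EuclideanSpace ℝ ι, exp (-(∑ p ∈ S, ∑ x ∈ cell p, (fun x t => 2 * w x t) x (ω x + ψ x))) ∂μ =
        ∫ ω, exp (-(2 * A ω)) ∂μ := by
      refine integral_congr_ae (ae_of_all _ fun ω => ?_)
      simp only [hA, mul_sum]
    rw [hint] at h
    exact (le_abs_self _).trans h
  -- the pure large-field quantity at coupling `2`
  have hQb : log (∫ ω, exp (-(2 * B ω)) ∂μ) ≤ (L.biUnion cell).card * (2 * (2 * κ₀) * (1 + τ) * γ / (2 * θ)) * (-log (1 - θ)) +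
      2 * κ₀ * (1 + τ⁻¹) * ∑ x ∈ L.biUnion cell, ψ x ^ 2 := by
    have h := log_integral_largeField_le hΓ hΓop (L.biUnion cell) (fun i _ => hdiag i) (fun x t => 2 * w x t) hw2 h2κ₀ hτ hθ0 hθ1
      hκθ' hstab2 (fun x => ψ x)
    have hint : ∫ ω : EuclideanSpace ℝ ι, exp (-(∑ x ∈ L.biUnion cell, (fun x t => 2 * w x t) x (ω x + ψ x))) ∂μ =
        ∫ ω, exp (-(2 * B ω)) ∂μ := by
      refine integral_congr_ae (ae_of_all _ fun ω => ?_)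
      simp only [hB]
      rw [← cellSum_eq_sum_biUnion cell hdisj L, mul_sum]
      simp_rw [mul_sum]
    rw [hint] at h
    exact h
  have h1 : (1 / 2 : ℝ) * log (∫ ω, exp (-(2 * A ω)) ∂μ) ≤ (1 / 2) * (S.card * ((Δ : ℝ) + 1) * (2 * (Real.exp 1 *
      (((max (exp (2 * c₃ * v * h ^ 3) - 1) (2 * exp (-((κ / 2 - 2 * κ₀) * h ^ 2)))) * exp (κ * (1 + τ⁻¹) * Ψ ^ 2 / 2)) *
        ((1 - θ) ^ (-(κ * (1 + τ) * γ / (2 * θ)))) ^ v)))) := mul_le_mul_of_nonneg_left hPa (by norm_num)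
  have h2 : (1 / 2 : ℝ) * log (∫ ω, exp (-(2 * B ω)) ∂μ) ≤ (1 / 2) * ((L.biUnion cell).card *
      (2 * (2 * κ₀) * (1 + τ) * γ / (2 * θ)) * (-log (1 - θ)) + 2 * κ₀ * (1 + τ⁻¹) * ∑ x ∈ L.biUnion cell, ψ x ^ 2) :=
    mul_le_mul_of_nonneg_left hQb (by norm_num)
  linarith

/-- **THE END, LOWER (Hölder) — `log Z_ψ(S ⊔ L) ≥ 2·[gas at coupling 1] − ½·[gas at coupling 2] − ½·[hole integral at coupling −2]`.**
Hypotheses of the upper bound, the smallness at coupling `1` as well (`e·ε₁A_τ^v(Δ+1)² ≤ 1∕2`), and the UPPER QUADRATIC bound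
`w_x(t) ≤ κ₁t²` (`κ₁ ≥ 0`, `4κ₁(1+τ)γ_op ≤ θ`) for the negative coupling ⟹
`log ∫e^{−Σ_{p∈S∪L}Σ_{x∈cell p}w_x(ω_x+ψ_x)}dN(0,Γ) ≥ −2·#S(Δ+1)2e·ε₁A_τ^v − ½·#S(Δ+1)2e·ε₂A_τ^v − ½·(#Y_L·(4κ₁(1+τ)γ∕(2θ))(−log(1−θ)) +
2κ₁(1+τ⁻¹)Σ_{x∈Y_L}ψ_x²)`. [folklore] -/
theorem le_log_integral_allField (hΓ : Γ.PosSemidef) (hΓop : (γop • (1 : Matrix ι ι ℝ) - Γ).PosSemidef) (hdiag : ∀ i, Γ i i ≤ γ)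
    (hγ : 0 ≤ γ) (hfr : HasFiniteRange dι ρ Γ) (hdisj : ∀ p q, p ≠ q → Disjoint (cell p) (cell q)) (hv : ∀ p, (cell p).card ≤ v)
    (hR : ∀ (p p' : V) (x y : ι), x ∈ cell p → y ∈ cell p' → dι x y ≤ ρ → p = p' ∨ R p p')
    (hΔ : ∀ x, (nbr x).card ≤ Δ) (hnbr : ∀ x y, R x y → y ∈ nbr x) (hw : ∀ x, Measurable (w x)) (hκ₀ : 0 ≤ κ₀) (hκ₁ : 0 ≤ κ₁)
    (hc₃ : 0 ≤ c₃) (hh : 0 ≤ h) (hstab : ∀ x, ∀ t : ℝ, -(κ₀ * t ^ 2) ≤ w x t) (hquad : ∀ x, ∀ t : ℝ, w x t ≤ κ₁ * t ^ 2)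
    (hcub : ∀ x, ∀ t : ℝ, |t| ≤ h → |w x t| ≤ c₃ * |t| ^ 3) (hκ : 4 * κ₀ ≤ κ) (hτ : 0 < τ) (hθ0 : 0 < θ) (hθ1 : θ < 1)
    (hκθ : κ * (1 + τ) * γop ≤ θ) (hκ₁θ : 4 * κ₁ * (1 + τ) * γop ≤ θ) (S L : Finset V) (hSL : Disjoint S L)
    (ψ : EuclideanSpace ℝ ι) (hψ : ∀ p ∈ S, ∑ x ∈ cell p, ψ x ^ 2 ≤ Ψ ^ 2)
    (hsmall₁ : Real.exp 1 * (((max (exp (c₃ * v * h ^ 3) - 1) (2 * exp (-((κ / 2 - κ₀) * h ^ 2)))) *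
      exp (κ * (1 + τ⁻¹) * Ψ ^ 2 / 2)) * ((1 - θ) ^ (-(κ * (1 + τ) * γ / (2 * θ)))) ^ v) * ((Δ : ℝ) + 1) ^ 2 ≤ 1 / 2)
    (hsmall₂ : Real.exp 1 * (((max (exp (2 * c₃ * v * h ^ 3) - 1) (2 * exp (-((κ / 2 - 2 * κ₀) * h ^ 2)))) *
      exp (κ * (1 + τ⁻¹) * Ψ ^ 2 / 2)) * ((1 - θ) ^ (-(κ * (1 + τ) * γ / (2 * θ)))) ^ v) * ((Δ : ℝ) + 1) ^ 2 ≤ 1 / 2) :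
    -(2 * (S.card * ((Δ : ℝ) + 1) * (2 * (Real.exp 1 * (((max (exp (c₃ * v * h ^ 3) - 1)
        (2 * exp (-((κ / 2 - κ₀) * h ^ 2)))) * exp (κ * (1 + τ⁻¹) * Ψ ^ 2 / 2)) *
        ((1 - θ) ^ (-(κ * (1 + τ) * γ / (2 * θ)))) ^ v))))) -
      (1 / 2) * (S.card * ((Δ : ℝ) + 1) * (2 * (Real.exp 1 * (((max (exp (2 * c₃ * v * h ^ 3) - 1)
        (2 * exp (-((κ / 2 - 2 * κ₀) * h ^ 2)))) * exp (κ * (1 + τ⁻¹) * Ψ ^ 2 / 2)) *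
        ((1 - θ) ^ (-(κ * (1 + τ) * γ / (2 * θ)))) ^ v)))) -
      (1 / 2) * ((L.biUnion cell).card * (2 * (2 * κ₁) * (1 + τ) * γ / (2 * θ)) * (-log (1 - θ)) +
        2 * κ₁ * (1 + τ⁻¹) * ∑ x ∈ L.biUnion cell, ψ x ^ 2) ≤
    log (∫ ω : EuclideanSpace ℝ ι, exp (-(∑ p ∈ S ∪ L, ∑ x ∈ cell p, w x (ω x + ψ x))) ∂(multivariateGaussian 0 Γ)) := by
  set μ := multivariateGaussian 0 Γ with hμ
  set A : EuclideanSpace ℝ ι → ℝ := fun ω => ∑ p ∈ S, ∑ x ∈ cell p, w x (ω x + ψ x) with hA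
  set B : EuclideanSpace ℝ ι → ℝ := fun ω => ∑ p ∈ L, ∑ x ∈ cell p, w x (ω x + ψ x) with hB
  have hAm : Measurable A := measurable_cellSum cell w hw S (fun x => ψ x)
  have hBm : Measurable B := measurable_cellSum cell w hw L (fun x => ψ x)
  have hnBm : Measurable (fun ω => -B ω) := hBm.neg
  have hsplit : ∀ ω : EuclideanSpace ℝ ι, ∑ p ∈ S ∪ L, ∑ x ∈ cell p, w x (ω x + ψ x) = A ω + B ω := fun ω => sum_union hSL
  simp_rw [hsplit]
  -- the scaled remainders `2w` and `−2w`
  have hstab2 : ∀ x, ∀ t : ℝ, -(2 * κ₀ * t ^ 2) ≤ (fun x t => 2 * w x t) x t := fun x t => by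
    have := hstab x t; simp only; linarith
  have hcub2 : ∀ x, ∀ t : ℝ, |t| ≤ h → |(fun x t => 2 * w x t) x t| ≤ 2 * c₃ * |t| ^ 3 := fun x t ht => by
    simp only [abs_mul, abs_two]; nlinarith [hcub x t ht]
  have hw2 : ∀ x, Measurable ((fun x t => 2 * w x t) x) := fun x => (hw x).const_mul 2
  have hstabm2 : ∀ x, ∀ t : ℝ, -(2 * κ₁ * t ^ 2) ≤ (fun x t => -(2 * w x t)) x t := fun x t => by
    have := hquad x t; simp only; linarith
  have hwm2 : ∀ x, Measurable ((fun x t => -(2 * w x t)) x) := fun x => ((hw x).const_mul 2).neg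
  have hκ2 : 2 * (2 * κ₀) ≤ κ := by linarith
  have hκ1' : 2 * κ₀ ≤ κ := by linarith
  have h2κ₀ : 0 ≤ 2 * κ₀ := by linarith
  have h2κ₁ : 0 ≤ 2 * κ₁ := by linarith
  have hsgn : 0 ≤ (1 + τ) * γop ∨ (1 + τ) * γop < 0 := le_or_gt 0 _
  have hκθ' : 2 * (2 * κ₀) * (1 + τ) * γop ≤ θ := by
    rcases hsgn with hpos | hneg
    · calc 2 * (2 * κ₀) * (1 + τ) * γop = (2 * (2 * κ₀)) * ((1 + τ) * γop) := by ring
        _ ≤ κ * ((1 + τ) * γop) := mul_le_mul_of_nonneg_right hκ2 hpos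
        _ = κ * (1 + τ) * γop := by ring
        _ ≤ θ := hκθ
    · have : 2 * (2 * κ₀) * (1 + τ) * γop = (2 * (2 * κ₀)) * ((1 + τ) * γop) := by ring
      have h' : (2 * (2 * κ₀)) * ((1 + τ) * γop) ≤ 0 := mul_nonpos_of_nonneg_of_nonpos (by linarith) hneg.le
      linarith
  have hκθ1 : 2 * κ₀ * (1 + τ) * γop ≤ θ := by
    rcases hsgn with hpos | hneg
    · calc 2 * κ₀ * (1 + τ) * γop = (2 * κ₀) * ((1 + τ) * γop) := by ring
        _ ≤ κ * ((1 + τ) * γop) := mul_le_mul_of_nonneg_right (by linarith) hpos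
        _ = κ * (1 + τ) * γop := by ring
        _ ≤ θ := hκθ
    · have : 2 * κ₀ * (1 + τ) * γop = (2 * κ₀) * ((1 + τ) * γop) := by ring
      have h' : (2 * κ₀) * ((1 + τ) * γop) ≤ 0 := mul_nonpos_of_nonneg_of_nonpos (by linarith) hneg.le
      linarith
  have hκ₁θ' : 2 * (2 * κ₁) * (1 + τ) * γop ≤ θ := by linarith
  -- integrability: `e^{−A}`, `e^{−2A}`, `e^{2B}`, hence `e^{−(A+B)}` and `e^{−(A−B)}`
  have hI0 : Integrable (fun ω => exp (-A ω)) μ := by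
    have h := integrable_exp_neg hΓ hΓop (S.biUnion cell) w hw hκ₀ hτ hθ1 hκθ1 hstab (fun x => ψ x)
    refine h.congr (ae_of_all _ fun ω => ?_)
    simp only [hA]
    rw [← cellSum_eq_sum_biUnion cell hdisj S]
  have hIA : Integrable (fun ω => exp (-(2 * A ω))) μ := by
    have h := integrable_exp_neg hΓ hΓop (S.biUnion cell) (fun x t => 2 * w x t) hw2 h2κ₀ hτ hθ1 hκθ' hstab2 (fun x => ψ x)
    refine h.congr (ae_of_all _ fun ω => ?_)
    simp only [hA]
    rw [← cellSum_eq_sum_biUnion cell hdisj S, mul_sum]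
    simp_rw [mul_sum]
  have hInB : Integrable (fun ω => exp (-(2 * (-B ω)))) μ := by
    have h := integrable_exp_neg hΓ hΓop (L.biUnion cell) (fun x t => -(2 * w x t)) hwm2 h2κ₁ hτ hθ1 hκ₁θ' hstabm2 (fun x => ψ x)
    refine h.congr (ae_of_all _ fun ω => ?_)
    simp only [hB]
    rw [← cellSum_eq_sum_biUnion cell hdisj L]
    simp only [sum_neg_distrib, neg_neg, mul_neg, mul_sum]
  have hIB : Integrable (fun ω => exp (-(2 * B ω))) μ := by
    have h := integrable_exp_neg hΓ hΓop (L.biUnion cell) (fun x t => 2 * w x t) hw2 h2κ₀ hτ hθ1 hκθ' hstab2 (fun x => ψ x)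
    refine h.congr (ae_of_all _ fun ω => ?_)
    simp only [hB]
    rw [← cellSum_eq_sum_biUnion cell hdisj L, mul_sum]
    simp_rw [mul_sum]
  have hI : Integrable (fun ω => exp (-(A ω + B ω))) μ := integrable_exp_neg_add hAm hBm Real.HolderConjugate.two_two hIA hIB
  have hI' : Integrable (fun ω => exp (-(A ω - B ω))) μ := by
    have h := integrable_exp_neg_add hAm hnBm Real.HolderConjugate.two_two hIA hInB
    refine h.congr (ae_of_all _ fun ω => ?_)
    simp only [sub_eq_add_neg]
  -- the reversed split at `θ = ½` and Hölder above for `A − B = A + (−B)`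
  have hlow := two_mul_log_sub_le (μ := μ) hAm hBm hI0 hI hI'
  have hmix : log (∫ ω, exp (-(A ω - B ω)) ∂μ) ≤
      (1 / 2) * log (∫ ω, exp (-(2 * A ω)) ∂μ) + (1 / 2) * log (∫ ω, exp (-(2 * (-B ω))) ∂μ) := by
    have h := log_integral_exp_neg_add_le (μ := μ) hAm hnBm Real.HolderConjugate.two_two hIA hInB
    have hint : ∫ ω, exp (-(A ω + -B ω)) ∂μ = ∫ ω, exp (-(A ω - B ω)) ∂μ :=
      integral_congr_ae (ae_of_all _ fun ω => by simp only [sub_eq_add_neg])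
    rw [hint] at h
    exact h
  -- the three pure quantities
  have hP₁ : -(S.card * ((Δ : ℝ) + 1) * (2 * (Real.exp 1 * (((max (exp (c₃ * v * h ^ 3) - 1)
      (2 * exp (-((κ / 2 - κ₀) * h ^ 2)))) * exp (κ * (1 + τ⁻¹) * Ψ ^ 2 / 2)) *
        ((1 - θ) ^ (-(κ * (1 + τ) * γ / (2 * θ)))) ^ v)))) ≤ log (∫ ω, exp (-A ω) ∂μ) := by
    have h := abs_log_integral_smallField_le hΓ hΓop hdiag hγ hfr cell hdisj hv hR hΔ hnbr w hw hκ₀ hc₃ hh hstab hcub hκ1' hτ hθ0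
      hθ1 hκθ S ψ hψ hsmall₁
    exact (abs_le.1 h).1
  have hPa : log (∫ ω, exp (-(2 * A ω)) ∂μ) ≤ S.card * ((Δ : ℝ) + 1) * (2 * (Real.exp 1 *
      (((max (exp (2 * c₃ * v * h ^ 3) - 1) (2 * exp (-((κ / 2 - 2 * κ₀) * h ^ 2)))) * exp (κ * (1 + τ⁻¹) * Ψ ^ 2 / 2)) *
        ((1 - θ) ^ (-(κ * (1 + τ) * γ / (2 * θ)))) ^ v))) := by
    have h := abs_log_integral_smallField_le hΓ hΓop hdiag hγ hfr cell hdisj hv hR hΔ hnbr (fun x t => 2 * w x t) hw2 h2κ₀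
      (by positivity) hh hstab2 hcub2 hκ2 hτ hθ0 hθ1 hκθ S ψ hψ hsmall₂
    have hint : ∫ ω : EuclideanSpace ℝ ι, exp (-(∑ p ∈ S, ∑ x ∈ cell p, (fun x t => 2 * w x t) x (ω x + ψ x))) ∂μ =
        ∫ ω, exp (-(2 * A ω)) ∂μ := by
      refine integral_congr_ae (ae_of_all _ fun ω => ?_)
      simp only [hA, mul_sum]
    rw [hint] at h
    exact (le_abs_self _).trans h
  have hQ : log (∫ ω, exp (-(2 * (-B ω))) ∂μ) ≤ (L.biUnion cell).card * (2 * (2 * κ₁) * (1 + τ) * γ / (2 * θ)) * (-log (1 - θ)) +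
      2 * κ₁ * (1 + τ⁻¹) * ∑ x ∈ L.biUnion cell, ψ x ^ 2 := by
    have h := log_integral_largeField_le hΓ hΓop (L.biUnion cell) (fun i _ => hdiag i) (fun x t => -(2 * w x t)) hwm2 h2κ₁ hτ hθ0
      hθ1 hκ₁θ' hstabm2 (fun x => ψ x)
    have hint : ∫ ω : EuclideanSpace ℝ ι, exp (-(∑ x ∈ L.biUnion cell, (fun x t => -(2 * w x t)) x (ω x + ψ x))) ∂μ =
        ∫ ω, exp (-(2 * (-B ω))) ∂μ := by
      refine integral_congr_ae (ae_of_all _ fun ω => ?_)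
      simp only [hB]
      rw [← cellSum_eq_sum_biUnion cell hdisj L]
      simp only [sum_neg_distrib, neg_neg, mul_neg, mul_sum]
    rw [hint] at h
    exact h
  have h1 : (1 / 2 : ℝ) * log (∫ ω, exp (-(2 * A ω)) ∂μ) ≤ (1 / 2) * (S.card * ((Δ : ℝ) + 1) * (2 * (Real.exp 1 *
      (((max (exp (2 * c₃ * v * h ^ 3) - 1) (2 * exp (-((κ / 2 - 2 * κ₀) * h ^ 2)))) * exp (κ * (1 + τ⁻¹) * Ψ ^ 2 / 2)) *
        ((1 - θ) ^ (-(κ * (1 + τ) * γ / (2 * θ)))) ^ v)))) := mul_le_mul_of_nonneg_left hPa (by norm_num)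
  have h2 : (1 / 2 : ℝ) * log (∫ ω, exp (-(2 * (-B ω))) ∂μ) ≤ (1 / 2) * ((L.biUnion cell).card *
      (2 * (2 * κ₁) * (1 + τ) * γ / (2 * θ)) * (-log (1 - θ)) + 2 * κ₁ * (1 + τ⁻¹) * ∑ x ∈ L.biUnion cell, ψ x ^ 2) :=
    mul_le_mul_of_nonneg_left hQ (by norm_num)
  linarith

/-- **THE END, LOWER (Jensen)** for GLOBALLY cubic remainders (`|w_x(t)| ≤ c₃|t|³` for all `t`): (297)'s lower bound on ALL the sites of
`S ∪ L` — `log ∫e^{−Σ_{p∈S∪L}Σ_{x∈cell p}w_x(ω_x+ψ_x)}dN(0,Γ) ≥ −4c₃Σ_{x∈⋃_{p∈S∪L}cell p}(Γ_xx + 3Γ_xx² + |ψ_x|³)`. [folklore] -/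
theorem le_log_integral_allField_jensen (hΓ : Γ.PosSemidef) (hΓop : (γop • (1 : Matrix ι ι ℝ) - Γ).PosSemidef)
    (hdisj : ∀ p q, p ≠ q → Disjoint (cell p) (cell q)) (hw : ∀ x, Measurable (w x)) (hκ₀ : 0 ≤ κ₀) (hc₃ : 0 ≤ c₃) (hτ : 0 < τ)
    (hθ1 : θ < 1) (hκθ : 2 * κ₀ * (1 + τ) * γop ≤ θ) (hstab : ∀ x, ∀ t : ℝ, -(κ₀ * t ^ 2) ≤ w x t)
    (hcub : ∀ x, ∀ t : ℝ, |w x t| ≤ c₃ * |t| ^ 3) (S L : Finset V) (ψ : EuclideanSpace ℝ ι) :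
    -(4 * c₃ * ∑ x ∈ (S ∪ L).biUnion cell, (Γ x x + 3 * Γ x x ^ 2 + |ψ x| ^ 3)) ≤
      log (∫ ω : EuclideanSpace ℝ ι, exp (-(∑ p ∈ S ∪ L, ∑ x ∈ cell p, w x (ω x + ψ x))) ∂(multivariateGaussian 0 Γ)) := by
  have h := le_integral_exp_neg hΓ hΓop ((S ∪ L).biUnion cell) w hw hκ₀ hc₃ hτ hθ1 hκθ hstab hcub (fun x => ψ x)
  have hint : ∫ ω : EuclideanSpace ℝ ι, exp (-(∑ x ∈ (S ∪ L).biUnion cell, w x (ω x + ψ x))) ∂(multivariateGaussian 0 Γ) =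
      ∫ ω : EuclideanSpace ℝ ι, exp (-(∑ p ∈ S ∪ L, ∑ x ∈ cell p, w x (ω x + ψ x))) ∂(multivariateGaussian 0 Γ) :=
    integral_congr_ae (ae_of_all _ fun ω => by dsimp only; rw [cellSum_eq_sum_biUnion cell hdisj (S ∪ L)])
  rw [hint] at h
  calc -(4 * c₃ * ∑ x ∈ (S ∪ L).biUnion cell, (Γ x x + 3 * Γ x x ^ 2 + |ψ x| ^ 3))
      = log (exp (-(4 * c₃ * ∑ x ∈ (S ∪ L).biUnion cell, (Γ x x + 3 * Γ x x ^ 2 + |ψ x| ^ 3)))) := (log_exp _).symm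
    _ ≤ _ := log_le_log (exp_pos _) h

end Assembly

/-! ## §2. Toy -/

/-- Toy: two disjoint cell families of a one-site lattice — the union sum splits as in the assembly (`Finset.sum_union`). -/
example (f : Unit → ℝ) : ∑ p ∈ (∅ : Finset Unit) ∪ {()}, f p = ∑ p ∈ (∅ : Finset Unit), f p + ∑ p ∈ ({()} : Finset Unit), f p :=
  sum_union (Finset.disjoint_empty_left _)

end Summit.QuantumFields.BalabanUV.T4Continuum.NE7b.SupAllFieldAssembly
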